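import Summits.QuantumAdvantage.AdviceFreeQNC0.GradedSeeds38

/-!
# Cell qa-qnc0, `p = 3` — GRADED seeds, part 2: the greedy decomposition (Lemma S) and the (J3) typed targets (planner qa-qnc0-p1 g38, ROUND-37 §2.3 / §3)

AUTHORED AND PROVED BY THE PLANNER SEAT qa-qnc0-p1 g38 (`HOME/qa-qnc0-p1/exp38/GradedSeeds38.lean` §3–§4, sha256 c1079ece5a4af769…,
farm rc 0 / 0 sorry); landed verbatim by qn-prover-3 g22 (ask P1-38a(1)); part 1 = `GradedSeeds38.lean` (§1 graded expansion, §2 Theorem G).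

§3 `exists_gradedSeeds` (Lemma S, any field): every family of forms has a maximal injective graded-spread seed sequence, and every
form is a seed combination plus a remainder of weight `< w R`.  §4 typed targets for the per-output (private) forms programme (J3):
`PerOutputFormsSharpX` (OPEN, crux-level), the PROVED span branch `perOutputForms_span` (corollary of Theorem G), `GradedSpreadOff`,
the analytic input `TwistedJuntaBoundX3` (OPEN, conjectural; cf. `AffBells36.TwistedJuntaBound3`), the structured class `SeedJuntaHardX`
and the reduction target `GradedJuntaReduction` (ROUND-37 §3.2; proved by the prover in `GradedSeeds38JuntaReduction.lean`).

WHAT THIS IS NOT: no claim on families whose greedy remainders are heavy (the residual core of (J3)_{r=1}, ROUND-37 §4); crux 22907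
untouched; nothing here is a ledger item (D-0168 shelf).
-/

noncomputable section

namespace Summit.QuantumAdvantage.AdviceFreeQNC0

open Finset Literature.Computability.QuantumComplexity Literature.Computability.MetaComplexity

namespace GradedSeeds38

/-! ## §3 The greedy graded-seed decomposition (any field; pure combinatorics) -/

section Greedy

variable {F : Type*} [Field F] [DecidableEq F] {κ ι : Type*} [Fintype κ] [DecidableEq κ] [Fintype ι] [DecidableEq ι]

/-- A seed sequence `s : Fin R → κ` of forms from the family `lam` is `w`-GRADED-SPREAD: every combination with top seed `j`
has at least `w j` non-zero coefficients. -/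
def SeqSpread (lam : κ → ι → F) (w : ℕ → ℕ) {R : ℕ} (s : Fin R → κ) : Prop :=
  ∀ (γ : Fin R → F) (j : Fin R), γ j ≠ 0 → (∀ i, j < i → γ i = 0) →
    w j.val ≤ (univ.filter fun m : ι => ∑ i, γ i * lam (s i) m ≠ 0).card

omit [Fintype κ] [DecidableEq κ] [DecidableEq ι] in
/-- Appending a form `k` to a graded-spread sequence: either the longer sequence is graded-spread, or `k` is a combination
of the seeds plus a remainder with fewer than `w R` non-zero coefficients. -/
theorem seqSpread_snoc_or (lam : κ → ι → F) (w : ℕ → ℕ) {R : ℕ} (s : Fin R → κ) (hs : SeqSpread lam w s) (k : κ) :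
    SeqSpread lam w (fun i : Fin (R + 1) => if h : i.val < R then s ⟨i.val, h⟩ else k) ∨
      ∃ a : Fin R → F, (univ.filter fun m : ι => lam k m - ∑ i, a i * lam (s i) m ≠ 0).card < w R := by
  classical
  by_cases hsp : SeqSpread lam w (fun i : Fin (R + 1) => if h : i.val < R then s ⟨i.val, h⟩ else k)
  · exact Or.inl hsp
  · right
    simp only [SeqSpread, not_forall, not_le, exists_prop] at hsp
    obtain ⟨γ, j, hγj, habove, hlt⟩ := hsp
    -- split the combination at the last index
    have hsum : ∀ m : ι, ∑ i : Fin (R + 1), γ i * lam (if h : i.val < R then s ⟨i.val, h⟩ else k) m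
        = ∑ i : Fin R, γ (Fin.castSucc i) * lam (s i) m + γ (Fin.last R) * lam k m := by
      intro m
      rw [Fin.sum_univ_castSucc]
      congr 1
      · refine sum_congr rfl fun i _ => ?_
        have hi : (Fin.castSucc i).val < R := by simp
        rw [dif_pos hi]
        congr 3
      · have hl : ¬ (Fin.last R).val < R := by simp
        rw [dif_neg hl]
    by_cases hjR : j.val < R
    · -- the top index is an old seed: contradicts the spread of `s`
      exfalso
      have hlast : γ (Fin.last R) = 0 := habove _ (Fin.lt_def.2 (by simp [hjR]))
      have h := hs (fun i => γ (Fin.castSucc i)) ⟨j.val, hjR⟩ (by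
          have : Fin.castSucc (⟨j.val, hjR⟩ : Fin R) = j := Fin.ext rfl
          rw [this]; exact hγj)
        (fun i hi => habove _ (Fin.lt_def.2 (by simpa [Fin.lt_def] using hi)))
      have hset : (univ.filter fun m : ι => ∑ i : Fin R, γ (Fin.castSucc i) * lam (s i) m ≠ 0)
          = univ.filter fun m : ι =>
              ∑ i : Fin (R + 1), γ i * lam (if h : i.val < R then s ⟨i.val, h⟩ else k) m ≠ 0 := by
        refine filter_congr fun m _ => ?_
        rw [hsum m, hlast, zero_mul, add_zero]
      rw [hset] at h
      simp only at hlt h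
      omega
    · -- the top index is the new form: normalise its coefficient
      have hjlast : j = Fin.last R := Fin.ext (by have := j.isLt; simp; omega)
      rw [hjlast] at hγj hlt
      refine ⟨fun i => -(γ (Fin.castSucc i) / γ (Fin.last R)), ?_⟩
      have hset : (univ.filter fun m : ι =>
            lam k m - ∑ i : Fin R, -(γ (Fin.castSucc i) / γ (Fin.last R)) * lam (s i) m ≠ 0)
          = univ.filter fun m : ι =>
              ∑ i : Fin (R + 1), γ i * lam (if h : i.val < R then s ⟨i.val, h⟩ else k) m ≠ 0 := by
        refine filter_congr fun m _ => ?_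
        rw [hsum m]
        have e : lam k m - ∑ i : Fin R, -(γ (Fin.castSucc i) / γ (Fin.last R)) * lam (s i) m
            = (γ (Fin.last R))⁻¹ * (∑ i : Fin R, γ (Fin.castSucc i) * lam (s i) m + γ (Fin.last R) * lam k m) := by
          rw [mul_add, mul_sum, ← mul_assoc, inv_mul_cancel₀ hγj, one_mul, sub_eq_add_neg, ← sum_neg_distrib, add_comm]
          congr 1
          refine sum_congr rfl fun i _ => ?_
          rw [div_eq_mul_inv]; ring
        rw [e]
        simp [hγj]
      rw [hset]
      simpa using hlt

omit [DecidableEq ι] in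
/-- **Greedy graded seeds** (ROUND-37 §2, Lemma S).  For every family of forms `lam : κ → (ι → F)` and every threshold schedule
`w` with `w n ≥ 1`, there is an injective seed sequence `s : Fin R → κ` which is `w`-graded-spread and MAXIMAL: every form of
the family is a combination of the seeds plus a remainder with fewer than `w R` non-zero coefficients.  (Take an injective
graded-spread sequence of maximal length; appending any further form breaks the spread at the top index.) -/
theorem exists_gradedSeeds (lam : κ → ι → F) (w : ℕ → ℕ) (hw : ∀ n, 0 < w n) :
    ∃ (R : ℕ) (s : Fin R → κ), Function.Injective s ∧ SeqSpread lam w s ∧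
      ∀ k : κ, ∃ a : Fin R → F, (univ.filter fun m : ι => lam k m - ∑ i, a i * lam (s i) m ≠ 0).card < w R := by
  classical
  -- lengths of injective graded-spread sequences are bounded by `card κ`
  obtain ⟨S, hS⟩ : ∃ S : Finset ℕ, S = (range (Fintype.card κ + 1)).filter fun n =>
      ∃ s : Fin n → κ, Function.Injective s ∧ SeqSpread lam w s := ⟨_, rfl⟩
  have hmemS : ∀ n, n ∈ S ↔ n < Fintype.card κ + 1 ∧ ∃ s : Fin n → κ, Function.Injective s ∧ SeqSpread lam w s := by
    intro n; rw [hS, mem_filter, mem_range]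
  have h0 : 0 ∈ S := (hmemS 0).2 ⟨by omega, fun i => i.elim0, fun i => i.elim0, fun γ j => j.elim0⟩
  have hSne : S.Nonempty := ⟨0, h0⟩
  obtain ⟨R, hR⟩ : ∃ R, R = S.max' hSne := ⟨_, rfl⟩
  have hRS : R ∈ S := by rw [hR]; exact max'_mem S hSne
  obtain ⟨-, s, hsinj, hssp⟩ := (hmemS R).1 hRS
  have hnot : ¬ ∃ s' : Fin (R + 1) → κ, Function.Injective s' ∧ SeqSpread lam w s' := by
    rintro ⟨s', hs'inj, hs'sp⟩
    have hcard : R + 1 ≤ Fintype.card κ := by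
      simpa using Fintype.card_le_of_injective s' hs'inj
    have hmem : R + 1 ∈ S := (hmemS (R + 1)).2 ⟨by omega, s', hs'inj, hs'sp⟩
    have := le_max' S (R + 1) hmem
    rw [← hR] at this
    omega
  refine ⟨R, s, hsinj, hssp, fun k => ?_⟩
  by_cases hk : ∃ j, s j = k
  · obtain ⟨j₀, hj₀⟩ := hk
    refine ⟨fun i => if i = j₀ then 1 else 0, ?_⟩
    have hzero : ∀ m : ι, lam k m - ∑ i, (if i = j₀ then (1 : F) else 0) * lam (s i) m = 0 := by
      intro m
      rw [Fintype.sum_eq_single j₀ (fun i hi => by rw [if_neg hi, zero_mul]), if_pos rfl, one_mul, hj₀, sub_self]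
    have : (univ.filter fun m : ι => lam k m - ∑ i, (if i = j₀ then (1 : F) else 0) * lam (s i) m ≠ 0) = ∅ :=
      filter_eq_empty_iff.2 fun m _ => by rw [hzero m]; exact not_not.2 rfl
    rw [this, card_empty]
    exact hw R
  · rcases seqSpread_snoc_or lam w s hssp k with hsp | hrem
    · exfalso
      refine hnot ⟨_, ?_, hsp⟩
      intro i i' hii'
      simp only at hii'
      by_cases hi : i.val < R <;> by_cases hi' : i'.val < R
      · rw [dif_pos hi, dif_pos hi'] at hii'
        exact Fin.ext (by have := congrArg Fin.val (hsinj hii'); simpa using this)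
      · rw [dif_pos hi, dif_neg hi'] at hii'
        exact absurd ⟨_, hii'⟩ hk
      · rw [dif_neg hi, dif_pos hi'] at hii'
        exact absurd ⟨_, hii'.symm⟩ hk
      · exact Fin.ext (by omega)
    · exact hrem

end Greedy

/-! ## §4 The per-output (private) forms programme (J3): typed targets and the proved span branch (ROUND-37 §3) -/

section Targets

/-- **(J3)ˣ, sharp form** — per-output PRIVATE forms (`r` forms per output, arbitrary tables), x-frame version of
`BlockFibre37.PerOutputFormsHardConst` with the conjectured sharp constant `2/3`.  OPEN (the crux-level target). -/
def PerOutputFormsSharpX : Prop :=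
  open scoped Classical in
  ∀ ε : ℝ, 0 < ε → ∀ r : ℕ, ∃ n₀ : ℕ, ∀ N ≥ n₀,
    ∀ (ℓ : Fin N → Fin r → Fin N → ZMod 3) (F : Fin N → (Fin r → ZMod 3) → Bool),
      ((univ.filter fun x : Fin N → Bool =>
          OddZeros x ∧ RingHLF.Rel x (fun k => xor (tGuess x k) (F k (LinForms.resVec (ℓ k) x)))).card : ℝ)
        ≤ (2 / 3 + ε) * (2 : ℝ) ^ (N - 1)

open scoped Classical in
/-- **PROVED branch of (J3)ˣ: private forms in the span of a graded-spread seed sequence.**  If the `r` private forms of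
every output are combinations (`a k t`) of ONE graded-spread seed sequence `c` (any length `R`), the strategy wins on
`≤ (2/3 + ε)·2^{N−1}` odd inputs.  (Corollary of `ringGradedSeedsSharp3`: re-table.) -/
theorem perOutputForms_span : ∀ ε : ℝ, 0 < ε → ∃ w₀ n₀ : ℕ, ∀ N ≥ n₀, ∀ (R : ℕ) (c : Fin R → Fin N → ZMod 3),
    GradedSpread c (fun j => 8 * (j.val + 1) + w₀) →
    ∀ (r : ℕ) (a : Fin N → Fin r → Fin R → ZMod 3) (F : Fin N → (Fin r → ZMod 3) → Bool),
      ((univ.filter fun x : Fin N → Bool =>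
          OddZeros x ∧ RingHLF.Rel x (fun k => xor (tGuess x k)
            (F k (fun t => ∑ i, a k t i * LinForms.resVec c x i)))).card : ℝ)
        ≤ (2 / 3 + ε) * (2 : ℝ) ^ (N - 1) := by
  intro ε hε
  obtain ⟨w₀, n₀, h⟩ := ringGradedSeedsSharp3 ε hε
  refine ⟨w₀, n₀, fun N hN R c hc r a F => ?_⟩
  exact h N hN R c hc (fun k v => F k (fun t => ∑ i, a k t i * v i))

/-- `GradedSpreadOff W c w`: graded spread counted OUTSIDE the tolerance set `W`. -/
def GradedSpreadOff {N R : ℕ} (W : Finset (Fin N)) (c : Fin R → Fin N → ZMod 3) (w : Fin R → ℕ) : Prop :=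
  ∀ (γ : Fin R → ZMod 3) (j : Fin R), IsTop γ j →
    w j ≤ (univ.filter fun m : Fin N => m ∉ W ∧ ∑ i, γ i * c i m ≠ 0).card

/-- **Twisted junta bound, x-frame** (the analytic input; cf. `AffBells36.TwistedJuntaBound3`, conjectural): twisted
win-sums of `W`-tolerant `(log₂N)^C`-junta strategies decay like `ρ^{#(supp β \ W)}`. -/
def TwistedJuntaBoundX3 (ρ : ℝ) : Prop :=
  open scoped Classical in
  ∀ C : ℕ, ∃ A n₀ : ℕ, ∀ N ≥ n₀,
    ∀ (W : Finset (Fin N)) (T : Fin N → Finset (Fin N)) (g : Fin N → (Fin N → Bool) → Bool),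
      3 * W.card ≤ N → (∀ k, (T k \ W).card ≤ (Nat.log 2 N) ^ C) →
      (∀ k (x x' : Fin N → Bool), (∀ i ∈ T k, x i = x' i) → g k x = g k x') →
        ∀ β : Fin N → ZMod 3,
          ‖∑ x : Fin N → Bool, (ZMod.stdAddChar (∑ i : Fin N, if x i then β i else 0) : ℂ) *
              (if (OddZeros x ∧ RingHLF.Rel x (fun k => g k x)) then (1 : ℂ) else 0)‖
            ≤ (N : ℝ) ^ A * ρ ^ (univ.filter fun i : Fin N => i ∉ W ∧ β i ≠ 0).card * (2 : ℝ) ^ N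

/-- **The structured branch (seed ⊕ junta strategies), x-frame.**  Bells `H k (seed residues) x` where `H k v ·` reads only
`T k` with `#(T k \ W) ≤ (log₂N)^C`, `3|W| ≤ N`, and the seeds are graded-spread outside `W` with schedule
`α(j+1) + D·log₂N`: such strategies win on `≤ θ·2^{N−1}`, one `θ < 1`. -/
def SeedJuntaHardX (α : ℕ) : Prop :=
  open scoped Classical in
  ∃ θ : ℝ, θ < 1 ∧ ∀ C : ℕ, ∃ D n₀ : ℕ, ∀ N ≥ n₀,
    ∀ (W : Finset (Fin N)) (R : ℕ) (c : Fin R → Fin N → ZMod 3) (T : Fin N → Finset (Fin N))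
      (H : Fin N → (Fin R → ZMod 3) → (Fin N → Bool) → Bool),
      3 * W.card ≤ N → GradedSpreadOff W c (fun j => α * (j.val + 1) + D * Nat.log 2 N) →
      (∀ k, (T k \ W).card ≤ (Nat.log 2 N) ^ C) →
      (∀ k v (x x' : Fin N → Bool), (∀ i ∈ T k, x i = x' i) → H k v x = H k v x') →
        ((univ.filter fun x : Fin N → Bool =>
            OddZeros x ∧ RingHLF.Rel x (fun k => H k (LinForms.resVec c x) x)).card : ℝ)
          ≤ θ * (2 : ℝ) ^ (N - 1)

/-- **TARGET `GradedJuntaReduction`** (ROUND-37 §3, paper proof = the proof of `ringGradedSeedsSharp3` with main term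
`AffBells34.coverPolylogHard` and error `Σ_j 3^{j+1} N^A ρ^{α(j+1) + D log₂N} 2^N`, `3ρ^α < 1`, `D` large): the twisted junta
bound transfers junta hardness to ALL seed ⊕ junta strategies, for every number `R` of seeds. -/
def GradedJuntaReduction : Prop :=
  ∀ (ρ : ℝ) (α : ℕ), 0 ≤ ρ → 3 * ρ ^ α < 1 → TwistedJuntaBoundX3 ρ → SeedJuntaHardX α

end Targets

end GradedSeeds38

end Summit.QuantumAdvantage.AdviceFreeQNC0

end
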